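import Summits.CriticalPhenomena.SAWScalingLimit.Theorems.SAWDevelopingMapHexConjectureWindowIneqMaximiser
import HarnessLib

/-!
# Crux `HexConjecture` (stmt-CriticalPhenomena-0808), line `root-locality-replaces-loewner`:
the window inequality along the discretisation families from the window-averaged arch locality (WAL ⟹ WIF)

Landing target:
`Summits/CriticalPhenomena/SAWScalingLimit/Theorems/SAWDevelopingMapHexConjectureWindowIneqFamiliesOfWindowLocality.lean`
(`--supports stmt-CriticalPhenomena-0808`; lead continuation prover-line-stmt-CriticalPhenomena-0808-c6-0).

The re-plumbed bootstrap consumes its lever only through the WINDOW INEQUALITY ALONG THE FAMILIES (WIF): eventually along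
`δ → 0⁺`, at the root cell `x` of the actual discretisation `Λ δ`,
`Σ_{d ∈ [θ₁ρ₂/δ, θ₀ρ₂/δ]} Far^{ρ₂/δ}_{Λδ}(s_x → t_d) ≤ η Σ_{same} Z_{Λδ}(s_x → t_d)` (`windowMaximiser_of_windowIneq`, p125107;
`windowLowerBound_of_windowIneq`, p125516).  This file records the trivial implication from the c5 lever WAL (the same inequality
with the half-box mass `Z_B` on the right, for ALL `R`, `x`, `Λ`, `B`, `S`): instantiate WAL at `R = ρ₂/δ`, the root cell, `Λ δ` and the
half-box `B = {v ∈ Λ δ : |c_v − mid a δ| ≤ R}` (which is the lattice half-box of radius `R` by the rigid-ball clause), and use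
`Z_B ≤ Z_{Λδ}` (exact restriction, `archMass_mono`).  Single-family hypotheses only.
Sources: LawlerSchrammWerner2004SAW (§3.4), DuminilCopinSmirnov2012 (Lemma 2).
-/

noncomputable section

open scoped BigOperators Topology Classical
open Filter Set Metric
open Literature.Probability.LatticeModels (HexVertex hexGraph hexCenter Site)
open Literature.Probability.RandomPlanarGeometry
open Literature.Probability.RandomPlanarGeometry.SAW
open Summit.CriticalPhenomena.SAWScalingLimit.Theorems.ObservableToSLE.FloorRatio

namespace Summit.CriticalPhenomena.SAWScalingLimit.Theorems.HexConjecture.RootLocality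

/-- The lattice radius `ρ₂/δ` exceeds `R₀` once the mesh is `≤ ρ₂/R₀`. [folklore] -/
theorem radius_ge_of_mesh_le {δ ρ₂ R₀ : ℝ} (hδ : 0 < δ) (hR₀ : 0 < R₀) (h : δ ≤ ρ₂ / R₀) : R₀ ≤ ρ₂ / δ := by
  rw [le_div_iff₀ hδ]
  calc R₀ * δ ≤ R₀ * (ρ₂ / R₀) := mul_le_mul_of_nonneg_left h hR₀.le
    _ = ρ₂ := by field_simp

/-- **WAL ⟹ WIF.**  The window-averaged arch locality (body of the registered `stub_windowArchLocality`) implies the window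
inequality along any admissible discretisation family of a domain flat at its root: for every radius `0 < ρ₂ ≤ ρ/2`, every `η > 0`,
the WAL bound `θb`, every `0 < θ₀ ≤ θb` and the WAL offset `θ₁`, eventually along `δ → 0⁺`.
[cite: LawlerSchrammWerner2004SAW, §3.4 ("SAW satisfies restriction")] -/
theorem windowIneqFamilies_of_windowLocality
    (hWAL : ∀ η : ℝ, 0 < η → ∃ θb : ℝ, 0 < θb ∧ ∀ θ₀ : ℝ, 0 < θ₀ → θ₀ ≤ θb →
      ∃ θ₁ : ℝ, 0 < θ₁ ∧ θ₁ < θ₀ ∧ ∃ R₀ : ℝ, 0 < R₀ ∧ ∀ R : ℝ, R₀ ≤ R →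
      ∀ (x : Site 2) (L B : Finset HexVertex) (S : Finset ℤ),
        (∀ v ∈ L, x 1 ≤ v.1 1) →
        (∀ v : HexVertex, v ∈ B ↔ (x 1 ≤ v.1 1 ∧
          dist (hexCenter v) (hexMidpoint s((x - Pi.single 1 1, 1), (x, 0))) ≤ R)) →
        (∀ d : ℤ, d ∈ S ↔ (θ₁ * R ≤ (d : ℝ) ∧ (d : ℝ) ≤ θ₀ * R)) →
        ∑ d ∈ S, (∑ γ : HexMidEdgeSAW L s((x - Pi.single 1 1, 1), (x, 0))
            s((x + Pi.single 0 d - Pi.single 1 1, 1), (x + Pi.single 0 d, 0)),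
          if ∃ v ∈ γ.verts, R ≤ dist (hexCenter v) (hexMidpoint s((x - Pi.single 1 1, 1), (x, 0)))
          then hexCriticalFugacity ^ γ.length else 0) ≤
        η * ∑ d ∈ S, ∑ γ : HexMidEdgeSAW B s((x - Pi.single 1 1, 1), (x, 0))
            s((x + Pi.single 0 d - Pi.single 1 1, 1), (x + Pi.single 0 d, 0)), hexCriticalFugacity ^ γ.length)
    (D : DobrushinDomain) (ρ : ℝ) (Λ : ℝ → Finset HexVertex) (m : ℝ → ℤ) (a : ℝ → Sym2 HexVertex)
    (hev : ∀ᶠ δ : ℝ in 𝓝[>] 0, a δ ∈ hexDomainBoundary (Λ δ) ∧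
      (∀ v ∈ Λ δ, (δ : ℂ) * hexCenter v ∈ D.carrier ∧ m δ ≤ v.1 1) ∧
      (∀ v : HexVertex, (δ : ℂ) * hexCenter v ∈ ball (D.pt 0) ρ → (v ∈ Λ δ ↔ m δ ≤ v.1 1)))
    (ha : Tendsto (fun δ : ℝ => (δ : ℂ) * hexMidpoint (a δ)) (𝓝[>] 0) (𝓝 (D.pt 0)))
    {ρ₂ : ℝ} (hρ₂ : 0 < ρ₂) (hρ₂ρ : ρ₂ ≤ ρ / 2) {η : ℝ} (hη : 0 < η) :
    ∃ θb : ℝ, 0 < θb ∧ ∀ θ₀ : ℝ, 0 < θ₀ → θ₀ ≤ θb → ∃ θ₁ : ℝ, 0 < θ₁ ∧ θ₁ < θ₀ ∧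
      ∀ᶠ δ : ℝ in 𝓝[>] 0, ∀ x : Site 2, x 1 = m δ → a δ = s((x - Pi.single 1 1, 1), (x, 0)) →
        ∑ d ∈ Finset.Icc ⌈θ₁ * (ρ₂ / δ)⌉ ⌊θ₀ * (ρ₂ / δ)⌋,
            (∑ γ : HexMidEdgeSAW (Λ δ) s((x - Pi.single 1 1, 1), (x, 0))
              s((x + Pi.single 0 d - Pi.single 1 1, 1), (x + Pi.single 0 d, 0)),
            if ∃ v ∈ γ.verts, ρ₂ / δ ≤ dist (hexCenter v) (hexMidpoint s((x - Pi.single 1 1, 1), (x, 0)))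
            then hexCriticalFugacity ^ γ.length else 0) ≤
          η * ∑ d ∈ Finset.Icc ⌈θ₁ * (ρ₂ / δ)⌉ ⌊θ₀ * (ρ₂ / δ)⌋,
            ∑ γ : HexMidEdgeSAW (Λ δ) s((x - Pi.single 1 1, 1), (x, 0))
              s((x + Pi.single 0 d - Pi.single 1 1, 1), (x + Pi.single 0 d, 0)), hexCriticalFugacity ^ γ.length := by
  obtain ⟨θb, hθb, hWθ⟩ := hWAL η hη
  refine ⟨θb, hθb, fun θ₀ hθ₀ hθ₀b => ?_⟩
  obtain ⟨θ₁, hθ₁, hθ₁₀, R₀, hR₀, hW⟩ := hWθ θ₀ hθ₀ hθ₀b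
  refine ⟨θ₁, hθ₁, hθ₁₀, ?_⟩
  set a₀ : ℂ := D.pt 0 with ha₀
  have e1 : ∀ᶠ δ : ℝ in 𝓝[>] 0, dist ((δ : ℂ) * hexMidpoint (a δ)) a₀ < ρ₂ / 2 :=
    Metric.tendsto_nhds.1 ha _ (by positivity)
  have e2 : ∀ᶠ δ : ℝ in 𝓝[>] 0, δ ≤ ρ₂ / R₀ := mem_nhdsWithin_of_mem_nhds (Iic_mem_nhds (by positivity))
  have e4 : ∀ᶠ δ : ℝ in 𝓝[>] 0, δ < ρ₂ / 2 := mem_nhdsWithin_of_mem_nhds (Iio_mem_nhds (by positivity))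
  filter_upwards [hev, e1, e2, e4, self_mem_nhdsWithin] with δ hevδ e1 e2 e4 hδ
  obtain ⟨_, hΛD, hrows⟩ := hevδ
  have hδ0 : (0 : ℝ) < δ := hδ
  intro x hx1 hax
  have hrowsΛ : ∀ v ∈ Λ δ, x 1 ≤ v.1 1 := fun v hv => hx1 ▸ (hΛD v hv).2
  -- the lattice radius
  set R : ℝ := ρ₂ / δ with hRdef
  have hRδ : δ * R = ρ₂ := by rw [hRdef]; field_simp
  have hR₀R : R₀ ≤ R := radius_ge_of_mesh_le hδ0 hR₀ e2
  -- the rigid ball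
  have hball : ∀ v : HexVertex, dist (hexCenter v) (hexMidpoint s((x - Pi.single 1 1, 1), (x, 0))) ≤ R + 1 / 2 →
      (δ : ℂ) * hexCenter v ∈ ball a₀ ρ := by
    intro v hv
    rw [← hax] at hv
    rw [mem_ball]
    have h := dist_mesh_le hδ0.le hv e1.le
    have h' : δ * (R + 1 / 2) = ρ₂ + δ / 2 := by rw [mul_add, hRδ]; ring
    calc dist ((δ : ℂ) * hexCenter v) a₀ ≤ δ * (R + 1 / 2) + ρ₂ / 2 := h
      _ = ρ₂ + δ / 2 + ρ₂ / 2 := by rw [h']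
      _ < ρ := by linarith
  -- the half-box
  set B : Finset HexVertex := (Λ δ).filter fun v =>
    dist (hexCenter v) (hexMidpoint s((x - Pi.single 1 1, 1), (x, 0))) ≤ R with hB
  have hBsub : B ⊆ Λ δ := Finset.filter_subset _ _
  have hBiff : ∀ v : HexVertex, v ∈ B ↔ (x 1 ≤ v.1 1 ∧
      dist (hexCenter v) (hexMidpoint s((x - Pi.single 1 1, 1), (x, 0))) ≤ R) := by
    intro v
    rw [hB, Finset.mem_filter]
    constructor
    · rintro ⟨hvΛ, hvd⟩; exact ⟨hrowsΛ v hvΛ, hvd⟩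
    · rintro ⟨hvrow, hvd⟩
      exact ⟨(hrows v (hball v (by linarith))).2 (hx1 ▸ hvrow), hvd⟩
  -- WAL at scale `R`, then `Z_B ≤ Z_Λ`
  have hWAL := hW R hR₀R x (Λ δ) B (Finset.Icc ⌈θ₁ * R⌉ ⌊θ₀ * R⌋) hrowsΛ hBiff (mem_window_iff θ₁ θ₀ R)
  refine hWAL.trans (mul_le_mul_of_nonneg_left (Finset.sum_le_sum fun d _ => ?_) hη.le)
  exact archMass_mono hBsub _ _

/-! ### Registered form -/

/-- **Registered sub-goal `stub_radiusGeOfMeshLe`** (crux item stmt-CriticalPhenomena-0808, line `root-locality-replaces-loewner`,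
lead continuation c6): the lattice radius exceeds the threshold for small mesh (`radius_ge_of_mesh_le`). [folklore] -/
theorem stub_radiusGeOfMeshLe : ∀ (δ ρ₂ R₀ : ℝ), 0 < δ → 0 < R₀ → δ ≤ ρ₂ / R₀ → R₀ ≤ ρ₂ / δ :=
  fun _ _ _ hδ hR₀ h => radius_ge_of_mesh_le hδ hR₀ h

end Summit.CriticalPhenomena.SAWScalingLimit.Theorems.HexConjecture.RootLocality

end
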